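import Literature.AlgebraicGeometry.AbelianSchemes.RigidifiedLineBundleComap
import Literature.AlgebraicGeometry.AbelianSchemes.AbelianSchemeDualTransport
import Literature.AlgebraicGeometry.AbelianSchemes.AbelianSchemeOverHomOfReduced
import Mathlib.AlgebraicGeometry.Morphisms.Separated
import Mathlib.FieldTheory.IsAlgClosed.AlgebraicClosure
import HarnessLib

/-!
# Rigidified fibrewise-`Pic⁰` families over a REDUCED base are determined by their geometric fibres

Layer `Literature/AlgebraicGeometry/AbelianSchemes`, namespace `Literature.AlgebraicGeometry.AbelianSchemes` (dot-notation on
★ `AbelianSchemeOver.DualPair`).  THEOREMS ONLY (no definition, no named fact, no instance).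

Setting of ★ D2 `AbelianSchemeOver.DualPair` ([MilneAV2008] I §8 over a base: `hat`, Poincaré `P`, `universal : ∀ f ℒ,
ℒ.FibrewisePicZero → ∃! g over f, (1_A × g)^*𝒫 ≅ ℒ`, with `D.classify` / `eq_classify` / `eq_of_nonempty_iso`) and of ★
`RigidifiedLineBundle.comap u` (restriction along `u : T′ → T`, module `(1_A × u)^*ℒ` via `comapLIso`,
`restrictLeft_comp_baseChangeToProd : (1_A × u) ≫ (1_A × g) = 1_A × (u ≫ g)`).

* §1 `eq_of_forall_geometricPoint_comp_eq` — **geometric points separate morphisms out of a REDUCED scheme into a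
  scheme separated over a common base** (Mathlib `ext_of_fromSpecResidueField_eq` on the dense set of ALL points +
  `Spec κ̄(x) → Spec κ(x)` dominant, Mathlib `ext_of_isDominant_of_isSeparated`; [GortzWedhorn2020] Prop. 9.2 style).  No
  finite-type hypothesis: the algebraically closed field varies with the point (`AlgebraicClosure κ(x)`).
* §2 `DualPair.nonempty_pullbackP_comp_iso_comap`, `DualPair.classify_comap` — **the classifying morphism is natural in
  the base**: `g_{ℒ|u} = u ≫ g_ℒ` (pull the universal isomorphism back along `1_A × u`, then uniqueness).
* §3 `DualPair.classify_eq_of_forall_fibre_iso`, **`DualPair.nonempty_iso_of_forall_fibre_iso`** — over a REDUCED `T`,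
  two rigidified fibrewise-`Pic⁰` line bundles on `A_T` whose restrictions `(1_A × t)^*ℒᵢ` along every GEOMETRIC point
  `t : Spec Ω → T` are isomorphic ARE isomorphic: their classifying morphisms agree on geometric points (§2 + uniqueness
  over `Spec Ω`), hence are equal (§1), and both bundles are `(1_A × g)^*𝒫`.
* §4 **`DualPair.nonempty_iso_unit_of_forall_fibre`** — in particular a rigidified fibrewise-`Pic⁰` family trivial on
  every geometric fibre is trivial (§3 against the trivial rigidified family `𝒪_{A_T}`).

This is [MumfordAV1970] §5 Cor. 6 / §10 «seesaw» in the form the dual pair gives for free over a reduced base (no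
`p_*𝒪 = 𝒪` and no cohomology-and-base-change is used: injectivity of `T(Ω) → Â(Ω)`-valued classifying maps on a reduced
`T` replaces it).  Cell `hodgecm-mathlib` (D-0151), HECKE-LINK H2 «dual pair of the quotient `A/C`» (B-p20 (g9) census
`CENSUS-H2-DualPairOfQuotient` §0.4 (d) / §1 D3, D6 (u2)): consumers = the `K′`-equivariant structure on `(π × 1)^*𝒫`
over the (smooth, hence reduced) base `Â′` and the `[n]`-identities of D6.  Count-neutral; HC_CM is proved only modulo
the 7 printed citations until rung 0 closes.

## References
* [MilneAV2008] J. S. Milne, *Abelian Varieties* (v2.00, 2008), I §8 pp. 36–37 (the dual pair, uniqueness of `α`).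
* [MumfordAV1970] D. Mumford, *Abelian Varieties* (1970), §5 Cor. 6 (p. 54), §8 ((iv) ⇔ (i)), §13 (p. 125).
* [GortzWedhorn2020] U. Görtz, T. Wedhorn, *Algebraic Geometry I* (2nd ed. 2020), Prop. 9.2, Section (4.7).
-/

set_option autoImplicit false

noncomputable section

universe u

open CategoryTheory CategoryTheory.Limits AlgebraicGeometry
open Literature.AlgebraicGeometry.AbelianVarieties Literature.AlgebraicGeometry.Modules

namespace Literature.AlgebraicGeometry.AbelianSchemes

/-! ## §1 Geometric points separate morphisms out of a reduced scheme -/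

/-- **Geometric points separate morphisms out of a REDUCED scheme** into a scheme separated over a common base: if
`f, g : T → X` agree over `Z` (`f ≫ i = g ≫ i`, `i` separated) and `t ≫ f = t ≫ g` for every algebraically closed field
`Ω` and every `t : Spec Ω → T`, then `f = g` — Mathlib `ext_of_fromSpecResidueField_eq` on the dense set of all points,
each residue field being reached from its algebraic closure by a surjective (hence dominant) `Spec κ̄(x) → Spec κ(x)`
(Mathlib `ext_of_isDominant_of_isSeparated`). [cite: GortzWedhorn2020, Prop. 9.2] -/
theorem eq_of_forall_geometricPoint_comp_eq {T X Z : Scheme.{u}} [IsReduced T] {f g : T ⟶ X} (i : X ⟶ Z)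
    [IsSeparated i] (hfg : f ≫ i = g ≫ i)
    (h : ∀ (Ω : Type u) [Field Ω] [IsAlgClosed Ω] (t : Spec (.of Ω) ⟶ T), t ≫ f = t ≫ g) : f = g := by
  refine ext_of_fromSpecResidueField_eq f g i Set.univ dense_univ (fun x _ => ?_) hfg
  let Ω : Type u := AlgebraicClosure (T.residueField x)
  let τ : T.residueField x ⟶ CommRingCat.of Ω := CommRingCat.ofHom (algebraMap (T.residueField x) Ω)
  have hH := h Ω (Spec.map τ ≫ T.fromSpecResidueField x)
  haveI : Surjective (Spec.map τ) := ⟨fun y ↦ ⟨IsLocalRing.closedPoint Ω, Subsingleton.elim _ _⟩⟩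
  refine ext_of_isDominant_of_isSeparated i ?_ (Spec.map τ) ?_
  · rw [Category.assoc, Category.assoc, hfg]
  · simpa only [Category.assoc] using hH

namespace AbelianSchemeOver

variable {S : Scheme.{u}} {A : AbelianSchemeOver S}

namespace DualPair

variable (D : A.DualPair) {T T' : Scheme.{u}} {f : T ⟶ S}

/-! ## §2 The classifying morphism is natural in the base -/

/-- **Pulling the universal isomorphism back along `1_A × u`**: if `(1_A × g)^*𝒫 ≅ ℒ` on `A_T`, then
`(1_A × (u ≫ g))^*𝒫 ≅ ℒ|_u` on `A_{T′}` (`(1_A × u)^*` of the given isomorphism, ★ `restrictLeft_comp_baseChangeToProd`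
and ★ `comapLIso`). [cite: MilneAV2008, I §8 pp. 36–37] [cite: GortzWedhorn2020, Section (4.7)] -/
theorem nonempty_pullbackP_comp_iso_comap (u : T' ⟶ T) (ℒ : A.RigidifiedLineBundle f) {g : T ⟶ D.hat.X.left}
    (hg : g ≫ D.hat.X.hom = f) (hug : (u ≫ g) ≫ D.hat.X.hom = u ≫ f)
    (h : Nonempty (D.pullbackP f g hg ≅ ℒ.L)) :
    Nonempty (D.pullbackP (u ≫ f) (u ≫ g) hug ≅ (ℒ.comap u).L) := by
  obtain ⟨i⟩ := h
  exact ⟨((Scheme.Modules.pullbackCongr (A.restrictLeft_comp_baseChangeToProd f u D.hat g hg)).app D.P).symm ≪≫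
    ((Scheme.Modules.pullbackComp (A.restrictLeft f u) (A.baseChangeToProd D.hat f g hg)).app D.P).symm ≪≫
    (Scheme.Modules.pullback (A.restrictLeft f u)).mapIso i ≪≫ (ℒ.comapLIso u).symm⟩

/-- **NATURALITY OF THE CLASSIFYING MORPHISM** ([MilneAV2008] I §8: uniqueness of `α`): the classifying morphism of
the restriction `ℒ|_u` along `u : T′ → T` is `u ≫ g_ℒ`. [cite: MilneAV2008, I §8 pp. 36–37] -/
theorem classify_comap (u : T' ⟶ T) (ℒ : A.RigidifiedLineBundle f) (hℒ : ℒ.FibrewisePicZero) :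
    D.classify (u ≫ f) (ℒ.comap u) (hℒ.comap u) = u ≫ D.classify f ℒ hℒ :=
  (D.eq_classify (u ≫ f) (ℒ.comap u) (hℒ.comap u) (u ≫ D.classify f ℒ hℒ)
    (by rw [Category.assoc, D.classify_comp_hom])
    (D.nonempty_pullbackP_comp_iso_comap u ℒ (D.classify_comp_hom f ℒ hℒ) _
      (D.nonempty_pullbackP_classify_iso f ℒ hℒ))).symm

/-! ## §3 Over a reduced base: fibrewise-isomorphic families are isomorphic -/

/-- **Over a REDUCED base two rigidified fibrewise-`Pic⁰` families with isomorphic geometric fibres have the same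
classifying morphism**: on each geometric point `t : Spec Ω → T` both `t ≫ g₁` and `t ≫ g₂` classify
`(1_A × t)^*ℒ₁ ≅ (1_A × t)^*ℒ₂` (§2), so they agree (uniqueness in ★ `universal` over `Spec Ω`); §1 on the
`S`-separated `Â`. [cite: MilneAV2008, I §8 pp. 36–37] [cite: MumfordAV1970, §5 Cor. 6 (p. 54)] -/
theorem classify_eq_of_forall_fibre_iso [IsReduced T] (ℒ₁ ℒ₂ : A.RigidifiedLineBundle f)
    (h₁ : ℒ₁.FibrewisePicZero) (h₂ : ℒ₂.FibrewisePicZero)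
    (hiso : ∀ (Ω : Type u) [Field Ω] [IsAlgClosed Ω] (t : Spec (.of Ω) ⟶ T),
      Nonempty ((Scheme.Modules.pullback (A.restrictLeft f t)).obj ℒ₁.L ≅
        (Scheme.Modules.pullback (A.restrictLeft f t)).obj ℒ₂.L)) :
    D.classify f ℒ₁ h₁ = D.classify f ℒ₂ h₂ := by
  haveI := D.hat.isSeparated_hom
  refine eq_of_forall_geometricPoint_comp_eq D.hat.X.hom
    (by rw [D.classify_comp_hom, D.classify_comp_hom]) fun Ω _ _ t => ?_
  obtain ⟨e⟩ := hiso Ω t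
  rw [← D.classify_comap t ℒ₁ h₁, ← D.classify_comap t ℒ₂ h₂]
  -- both `t ≫ g₁` and `t ≫ g₂` pull `𝒫` back to `ℒ₁|_t ≅ ℒ₂|_t`
  refine D.eq_of_nonempty_iso (t ≫ f) (ℒ₁.comap t) (h₁.comap t) _ _ (D.classify_comp_hom _ _ _)
    (D.classify_comp_hom _ _ _) (D.nonempty_pullbackP_classify_iso _ _ _) ?_
  obtain ⟨i₂⟩ := D.nonempty_pullbackP_classify_iso (t ≫ f) (ℒ₂.comap t) (h₂.comap t)
  exact ⟨i₂ ≪≫ ℒ₂.comapLIso t ≪≫ e.symm ≪≫ (ℒ₁.comapLIso t).symm⟩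

/-- **RIGIDIFIED `Pic⁰`-FAMILIES OVER A REDUCED BASE ARE DETERMINED BY THEIR GEOMETRIC FIBRES**: for `T` reduced, two
rigidified fibrewise-`Pic⁰` line bundles `ℒ₁, ℒ₂` on `A_T` with `(1_A × t)^*ℒ₁ ≅ (1_A × t)^*ℒ₂` for every geometric
point `t : Spec Ω → T` are isomorphic (both are `(1_A × g)^*𝒫` for the common classifying morphism `g`; the dual
pair `D` is the explicit first argument). [cite: MilneAV2008, I §8 pp. 36–37] [cite: MumfordAV1970, §5 Cor. 6 (p. 54) and §13 (p. 125)] -/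
theorem nonempty_iso_of_forall_fibre_iso (D : A.DualPair) [IsReduced T] (ℒ₁ ℒ₂ : A.RigidifiedLineBundle f)
    (h₁ : ℒ₁.FibrewisePicZero) (h₂ : ℒ₂.FibrewisePicZero)
    (hiso : ∀ (Ω : Type u) [Field Ω] [IsAlgClosed Ω] (t : Spec (.of Ω) ⟶ T),
      Nonempty ((Scheme.Modules.pullback (A.restrictLeft f t)).obj ℒ₁.L ≅
        (Scheme.Modules.pullback (A.restrictLeft f t)).obj ℒ₂.L)) :
    Nonempty (ℒ₁.L ≅ ℒ₂.L) := by
  obtain ⟨i₁⟩ := D.nonempty_pullbackP_classify_iso f ℒ₁ h₁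
  obtain ⟨i₂⟩ := D.nonempty_pullbackP_classify_iso f ℒ₂ h₂
  have hg := D.classify_eq_of_forall_fibre_iso ℒ₁ ℒ₂ h₁ h₂ hiso
  have hP : D.pullbackP f (D.classify f ℒ₁ h₁) (D.classify_comp_hom f ℒ₁ h₁) =
      D.pullbackP f (D.classify f ℒ₂ h₂) (D.classify_comp_hom f ℒ₂ h₂) :=
    D.pullbackP_congr f hg _ _
  exact ⟨i₁.symm ≪≫ eqToIso hP ≪≫ i₂⟩

/-! ## §4 Over a reduced base: a family trivial on every geometric fibre is trivial -/

/-- **A rigidified fibrewise-`Pic⁰` family over a REDUCED base which is trivial on every geometric fibre is trivial**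
(§3 against the trivial rigidified family `𝒪_{A_T}`, which lies fibrewise in `Pic⁰` — ★ `isHomogeneous_unit`; the dual
pair `D` is the explicit first argument). [cite: MilneAV2008, I §8 pp. 36–37] [cite: MumfordAV1970, §5 Cor. 6 (p. 54) and §13 (p. 125)] -/
theorem nonempty_iso_unit_of_forall_fibre (D : A.DualPair) [IsReduced T] (ℒ : A.RigidifiedLineBundle f) (hℒ : ℒ.FibrewisePicZero)
    (h : ∀ (Ω : Type u) [Field Ω] [IsAlgClosed Ω] (t : Spec (.of Ω) ⟶ T),
      Nonempty ((Scheme.Modules.pullback (A.restrictLeft f t)).obj ℒ.L ≅ SheafOfModules.unit _)) :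
    Nonempty (ℒ.L ≅ SheafOfModules.unit _) := by
  -- the trivial rigidified family `𝒪` on `A_T`
  let 𝒪T : A.RigidifiedLineBundle f :=
    { L := SheafOfModules.unit _
      hasRank_one := hasRank_unit_one
      rigid := ⟨RigidifiedLineBundle.pullbackUnitIso _⟩ }
  have h𝒪 : 𝒪T.FibrewisePicZero := fun Ω _ _ t =>
    (isHomogeneous_iff_of_iso _ (RigidifiedLineBundle.pullbackUnitIso _)).2 (isHomogeneous_unit _)
  exact D.nonempty_iso_of_forall_fibre_iso ℒ 𝒪T hℒ h𝒪 fun Ω _ _ t =>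
    (h Ω t).map fun e => e ≪≫ (RigidifiedLineBundle.pullbackUnitIso (A.restrictLeft f t)).symm

end DualPair

end AbelianSchemeOver

end Literature.AlgebraicGeometry.AbelianSchemes

end
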